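import Literature.Claims.NS.ClayVariants
import Literature.Analysis.FluidPDE.NSVorticity
import Literature.Analysis.FluidPDE.ClassicalNSBlowupAlternative
import Literature.Analysis.FluidPDE.NSVorticityBKMContinuation
import Literature.Analysis.FluidPDE.ClassicalSobolevUniqueness
import Literature.Analysis.FluidPDE.ClassicalNSEnergyEqualityNonnegViscosity
import Literature.Analysis.FluidPDE.TaoLocalisationContinuation
import Literature.Analysis.FluidPDE.SereginSverak2002CaseB
import Literature.Analysis.FluidPDE.LerayHopfFinalWeakSlice
import Literature.Analysis.FluidPDE.BaeChoeTwoVelocityComponentsCriterion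
import Literature.Analysis.FluidPDE.LeslieShvydkoy2018SlicePressure
import Literature.Analysis.FluidPDE.NSCriticalClosureTao
import Literature.Analysis.FluidPDE.NormalisedPressureDischarge
import Literature.Analysis.FluidPDE.PressureRepresentation
import Literature.Analysis.FluidPDE.NSSuitableESSPressureProofs
import HarnessLib

/-!
# Claim skeleton: Kyritsis (2021 preprint), «Solution of the Clay Millennium problem about the
# regularity of the Navier–Stokes equations» — the «pressures» argument (K-II)

Cell `ns-claims` (D-0090 NS-CLAIMS SWEEP), claim C03b, typist `ns-claims-typist-3`.
UNREFEREED/DISPUTED CLAIM under adjudication — NOTHING in this file asserts a step: every `Step_k`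
is a `Prop` (the paper's k-th load-bearing assertion, typed concretely so that `¬ Step_k` or its
vacuity can be a kernel theorem, to be filed by a refuter summit-side as
`Theorems/SoloRefuteKyritsis2021.lean`); the only `theorem`s are the kernel COMPOSITIONS of the
paper's own implications and unfolding lemmas.

Version of record (pinned by ns-claims-lit-3, ASSIGNMENTS v1.1 row C03b): K. E. Kyritsis,
«Solution of the Clay Millennium problem about the regularity of the Navier-Stokes equations»,
preprint 2021 (OpenAlex W3199217215, 26 pp., no print pagination — locators are PDF pages)
[Kyritsis2021b]; materialised `pub/ns-claims/sources/Kyritsis2022/Preprint2021-W3199217215/`,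
locators `sources/Kyritsis2022/LOCATORS.md` §3 (the Feb-2018 form is arXiv:1902.07265v1 part B,
3rd paper, PDF pp. 83–113, Props 4.1/5.1/5.2 at pp. 100/106/109). This is the author's SECOND
argument (pressures bounded through «virtual work of the pressure forces on bundles of instantaneous
paths»); his circulation argument is `Kyritsis2022.lean` (C03), his «conservation of particles»
argument is C03c. Remark 5.3 (p. 22): Euler regularity is NOT claimed here.

## Claimed statement (as printed)

PROPOSITION 5.2, p. 22: «(The solution of the 4th Clay Millennium problem). Let a local in time,
t in [0,T), smooth flow solution with velocities u(x,t), of the Navier-Stokes equations of viscous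
fluids with smooth Schwartz initial data, and finite initial energy E(0), as in the standard
formulation of the 4th Clay Millennium problem. Then the solution is regular, in other words it can
be extended as smooth solution for all times t in [0,+∞).» (The proof adds: «not only there is not a
blow-up at finite time but also … no blow-up even at time = +∞» — a sentence without a typed content
here.) Typed: `ClaimedTheorem` — every smooth solution on `[0,T)` in the class of Prop. 3.1/3.2 (the
H¹-mild smooth class of Tao 2013 Thm 5.4, rendered as the tree's BKM class: classical solution with
all `L²` Sobolev norms bounded on compact sub-intervals) from a Clay datum is the restriction of a
global one.

## Clay delta (reference `ClayVariants.lean`)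

Nearest: (A) (p. 2: «I consider the conjecture (A) … which I identify throughout the paper as the
4th Clay millennium problem»). Axes: domain ℝ³ = · force ≡ 0 = · data «smooth Schwartz, finite
energy» = (4) (Δ4 EQUIVALENT) · solution notion: continuation of the local smooth solution (Δ6
«no blow-up» form; with Prop. 3.2 (existence) and the energy inequality it yields (A):
`clayA_of_claimed`) · horizon [0,∞) = · viscosity ∀ ν > 0 =. Not a «wrong problem» candidate.

## Steps (paper item · PDF page · typist's private flag)

* `Step_1`  PROP 3.2 (pp. 7–8; = Tao 2013 Thm 5.4 / Majda–Bertozzi Thm 3.4) with PROP 3.10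
  (p. 13, maximal Cauchy development = Tao 2013 Cor 5.8): local existence, uniqueness and the
  global-or-maximal alternative in the class, `ν > 0` — plausible (known) — PROVED in-file, `step_1_holds`
  (revision: `finiteEnergy_classical_dichotomy` + persistence of regularity + Sobolev-class uniqueness).
* `Step_2`  the energy inequality, eqs. (8)–(13), pp. 9–10 (Remark 3.2; Majda–Bertozzi Prop. 1.13
  (1.80)): `E(t) ≤ E(s)` for `s ≤ t`, `ν ≥ 0` — plausible (known).
* `Step_3`  PROP 3.4 (p. 9): global regularity for compactly supported smooth data WITH compactly
  supported smooth forcing ⇒ global regularity for Schwartz data, `f ≡ 0` (proof deferred to the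
  author's 2017 «Proposition 6.4») — plausible (Tao-2013-type localisation); NOT consumed by the
  composition that types (its antecedent is a FORCED statement that §§4–5 do not supply — LOGIC note).
* `Step_4`  PROP 4.1 (pp. 15–17) in the reading consumed by the proof of PROP 5.2 («pressures …
  bounded in finite time intervals», whole space, normalisation-free = bounded OSCILLATION):
  bounded pressure oscillation on `[0,T*)` ⇒ continuation past `T*`, `ν > 0` — plausible (a
  whole-space bounded-pressure criterion is in print: Seregin–Šverák 2002); the PRINTED proof
  (eqs. (24)–(27): «the friction term only subtracts from the pressure forces») is not typed
  (erratum-grade support of a plausible statement, MAP-SCHEMA §1b); the printed restriction to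
  «the compact support V(t)» is recorded in the docstring of `Step_4`.
* `Step_5`  eqs. (34)–(35)/(37) (pp. 20–21), the INTERMEDIATE of PROP 5.1: the «work of the pressure
  forces on the test fluid filling a double circular cone with vertices x₁, x₂», `W = c·V·|p(x₂) −
  p(x₁)|` (34), satisfies `W ≤ E(t)` (35)/(37) — known-false pattern (energy is supercritical; and
  `V → ∞` for wide cones at fixed vertices).
* `Step_6`  PROP 5.1 (p. 19, statement), LOAD-BEARING for PROP 5.2: `|p(x₂,t) − p(x₁,t)| ≤ k·E(0)`
  for all pairs of points and all times of existence, `k` depending on the datum, `ν ≥ 0` —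
  suspicious / open-strength (for `ν > 0` it yields regularity through `Step_4`; its printed proof
  rests on `Step_5`).
Ordered index (TYPING-HYGIENE 11): Step 1 = `Step_1` (Prop 3.2 + 3.10, pp. 7–8, 13) · Step 2 =
`Step_2` (eqs. (8)–(13), pp. 9–10) · Step 3 = `Step_3` (Prop 3.4, p. 9) · Step 4 = `Step_4` (Prop 4.1,
pp. 15–17) · Step 5 = `Step_5` (eqs. (34)–(35)/(37), pp. 20–21) · Step 6 = `Step_6` (Prop 5.1, p. 19).
Not typed as steps (not load-bearing): Props 3.3, 3.5–3.9 (criteria recalled from the literature;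
3.9 «Fefferman's velocity criterion» is used only inside the untyped proof of Prop 4.1), Prop 4.2
(p. 17, trajectory lengths), Props 3.11–3.14 (potential theory), §5 remarks 1)–4) (pp. 18–19).

## COMPOSITION — proved as `claim_of_steps`

* `step6_of_steps : Step_2 → Step_5 → Step_6` — PROVED (the printed proof of Prop 5.1: (35) at time
  `t` for the cone of unit volume, then `E(t) ≤ E(0)`, eqs. (36)–(38), p. 21; `k = 1`).
* `claim_of_steps : Step_1 → … → Step_6 → ClaimedTheorem` — PROVED; consumes Steps 1, 4, 6 (Prop 5.2's
  five-line proof, p. 22: Prop 5.1 ⇒ bounded pressures ⇒ Prop 4.1; plus the maximal-development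
  alternative and uniqueness of Step 1). `Step_3` is not consumed (see above); `Step_2`, `Step_5`
  enter only through `step6_of_steps`.
* `clayA_of_claimed : Step_1 → Step_2 → ClaimedTheorem → clayR3.Regularity` — PROVED (the author's
  identification of Prop 5.2 with Conjecture (A), p. 2 and p. 22).

Design: space `EuclideanSpace ℝ (Fin 3)` spelled out; solutions = the tree's
`IsClassicalNSSolutionOn S ν 0 u p` with the BKM class `HasBoundedSobolevNormsOn` on compact
sub-intervals (`IsLocalClassSolution`, `IsGlobalClassSolution`); continuation = the tree's
`HasSobolevExtensionPast`; energy `E(t) = ½∫|u|²` as a lower Lebesgue integral (`energy`, no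
integrability side condition); pressure DIFFERENCES only (normalisation-free, exactly Prop 5.1's
«pressure variance»); the double circular cone enters only through its volume `πR²‖x₂−x₁‖/3`
(`doubleConeVolume`) and eq. (34)'s `W` (`coneWork`, `c = ρ = 1`).

WHAT THIS IS NOT: not a claim about NS regularity or blow-up; not a claim about any author beyond the
typed locator.
-/

open MeasureTheory Set Filter
open scoped ContDiff ENNReal Topology

namespace Literature.Claims.NS.Kyritsis2021

open Literature.Analysis.FluidPDE

noncomputable section

/-! ## Vocabulary (definitions with bodies; nothing asserted) -/

/-- «Smooth (local in time) solution in the sense of Propositions 3.1–3.2» (pp. 7–8: the H¹-mild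
smooth solution of Tao 2013 Thm 5.4 (iv), `∂ₜʲu, ∂ₜʲp ∈ L^∞_t H^k` for all `j, k`), rendered in the
tree's vocabulary: a classical unforced Navier–Stokes solution on `ℝ³ × [0,T)` whose spatial `L²`
Sobolev norms of every order are bounded on each `[0,T'']`, `T'' < T` (the Beale–Kato–Majda class
`HasBoundedSobolevNormsOn`). [cite: Kyritsis2021b, Props 3.1–3.2, pp. 7–8] -/
def IsLocalClassSolution (ν T : ℝ)
    (u : ℝ → EuclideanSpace ℝ (Fin 3) → EuclideanSpace ℝ (Fin 3))
    (p : ℝ → EuclideanSpace ℝ (Fin 3) → ℝ) : Prop :=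
  IsClassicalNSSolutionOn (Ico 0 T) ν 0 u p ∧ ∀ T'' < T, HasBoundedSobolevNormsOn (Icc 0 T'') u

/-- The global version of `IsLocalClassSolution`: a classical unforced solution on `ℝ³ × [0,∞)` in
the class on every `[0,T'']` («extended as smooth solution for all times», Prop 5.2, p. 22).
[cite: Kyritsis2021b, Prop 5.2, p. 22] -/
def IsGlobalClassSolution (ν : ℝ)
    (u : ℝ → EuclideanSpace ℝ (Fin 3) → EuclideanSpace ℝ (Fin 3))
    (p : ℝ → EuclideanSpace ℝ (Fin 3) → ℝ) : Prop :=
  IsClassicalNSSolutionOn (Ici 0) ν 0 u p ∧ ∀ T'' : ℝ, HasBoundedSobolevNormsOn (Icc 0 T'') u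

/-- The kinetic energy `E(t) = ½ ∫ |u(x,t)|² dx` (eqs. (9)–(10), pp. 9–10), as a lower Lebesgue
integral in `ℝ≥0∞` (no integrability side condition, no junk value).
[cite: Kyritsis2021b, eqs. (9)–(10), pp. 9–10] -/
def energy (u : ℝ → EuclideanSpace ℝ (Fin 3) → EuclideanSpace ℝ (Fin 3)) (t : ℝ) : ℝ≥0∞ :=
  2⁻¹ * ∫⁻ x, ‖u t x‖ₑ ^ 2

/-- The volume `π R² ‖x₂ − x₁‖ / 3` of the DOUBLE CIRCULAR CONE `DC(x₁, x₂)` of the proof of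
Prop 5.1 (p. 20): «two circular cones united at their circular bases C and with vertices x₁(0),
x₂(0) opposite to the plane of the common circular base C», base radius `R` (elementary: two cones
of base area `πR²` and heights summing to `‖x₂ − x₁‖`). The cone itself enters the argument only
through this number. [cite: Kyritsis2021b, proof of Prop 5.1, p. 20] -/
def doubleConeVolume (x₁ x₂ : EuclideanSpace ℝ (Fin 3)) (R : ℝ) : ℝ :=
  Real.pi * R ^ 2 * ‖x₂ - x₁‖ / 3

/-- Eq. (34), p. 20: the «work done by the pressure forces of the original fluid as projected to the
assumed paths» filling the double cone, `W = c·V·|p(x₂) − p(x₁)|` with `c = ρ = 1` (p. 19: the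
density «is custom to either normalised to 1») and `V` the volume of the double cone.
[cite: Kyritsis2021b, eq. (34), p. 20] -/
def coneWork (p : ℝ → EuclideanSpace ℝ (Fin 3) → ℝ) (t : ℝ) (x₁ x₂ : EuclideanSpace ℝ (Fin 3))
    (R : ℝ) : ℝ :=
  doubleConeVolume x₁ x₂ R * |p t x₂ - p t x₁|

/-- For distinct vertices the double cone of base radius `√(3 / (π‖x₂ − x₁‖))` has volume `1`
(bookkeeping for the composition `step6_of_steps`). [cite: Kyritsis2021b, proof of Prop 5.1, p. 20] -/
theorem doubleConeVolume_eq_one {x₁ x₂ : EuclideanSpace ℝ (Fin 3)} (h : x₁ ≠ x₂) :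
    doubleConeVolume x₁ x₂ (Real.sqrt (3 / (Real.pi * ‖x₂ - x₁‖))) = 1 := by
  have hd : 0 < ‖x₂ - x₁‖ := norm_pos_iff.mpr (sub_ne_zero.mpr (Ne.symm h))
  have hπ : 0 < Real.pi := Real.pi_pos
  unfold doubleConeVolume
  rw [Real.sq_sqrt (by positivity)]
  field_simp

/-! ## The claimed statement -/

/-- **PROPOSITION 5.2 (p. 22), as printed — «The solution of the 4th Clay Millennium problem»:**
every local-in-time smooth solution on `[0,T)` (in the class of Props 3.1–3.2) of the Navier–Stokes
equations, `ν > 0`, `f ≡ 0`, from a smooth divergence-free rapidly decaying («Schwartz», hence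
finite-energy) datum «can be extended as smooth solution for all times t in [0,+∞)»: it is the
restriction of a global solution in the class. [cite: Kyritsis2021b, Prop 5.2, p. 22] -/
def ClaimedTheorem : Prop :=
  ∀ ν : ℝ, 0 < ν →
    ∀ u₀ : EuclideanSpace ℝ (Fin 3) → EuclideanSpace ℝ (Fin 3), ContDiff ℝ ∞ u₀ →
      NSWave0.IsDivFree u₀ → HasRapidSpatialDecay u₀ →
    ∀ T : ℝ, 0 < T →
    ∀ (u : ℝ → EuclideanSpace ℝ (Fin 3) → EuclideanSpace ℝ (Fin 3))
      (p : ℝ → EuclideanSpace ℝ (Fin 3) → ℝ), IsLocalClassSolution ν T u p → u 0 = u₀ →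
    ∃ (u' : ℝ → EuclideanSpace ℝ (Fin 3) → EuclideanSpace ℝ (Fin 3))
      (p' : ℝ → EuclideanSpace ℝ (Fin 3) → ℝ),
      IsGlobalClassSolution ν u' p' ∧ ∀ t ∈ Ico 0 T, u' t = u t

/-! ## The steps -/

/-- **Step 1 — PROP 3.2 (pp. 7–8: «Local existence and uniqueness of smooth solutions or smooth well
posedness. Let u₀(x), p₀(x) be smooth and Schwartz initial data … then there is a finite time
interval [0,T] … so that there is a unique smooth local in time solution», from Tao 2013 Thm 5.4 =
Prop 3.1, or Majda–Bertozzi Thm 3.4) together with PROP 3.10 (p. 13, «Maximum Cauchy development»,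
Tao 2013 Cor 5.8).** Typed for `ν > 0` and a Clay datum as (i) the alternative: EITHER a global
solution in the class OR a solution in the class on some `[0,T*)`, `0 < T* < ∞`, with no continuation
in the class past `T*`; and (ii) uniqueness in the class on a common interval. Typist's flag:
plausible (known theory). [cite: Kyritsis2021b, Prop 3.2 pp. 7–8 and Prop 3.10 p. 13] -/
def Step_1 : Prop :=
  ∀ ν : ℝ, 0 < ν →
    ∀ u₀ : EuclideanSpace ℝ (Fin 3) → EuclideanSpace ℝ (Fin 3), ContDiff ℝ ∞ u₀ →
      NSWave0.IsDivFree u₀ → HasRapidSpatialDecay u₀ →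
      ((∃ (u : ℝ → EuclideanSpace ℝ (Fin 3) → EuclideanSpace ℝ (Fin 3))
          (p : ℝ → EuclideanSpace ℝ (Fin 3) → ℝ), IsGlobalClassSolution ν u p ∧ u 0 = u₀) ∨
        (∃ T : ℝ, 0 < T ∧
          ∃ (u : ℝ → EuclideanSpace ℝ (Fin 3) → EuclideanSpace ℝ (Fin 3))
            (p : ℝ → EuclideanSpace ℝ (Fin 3) → ℝ),
            IsLocalClassSolution ν T u p ∧ u 0 = u₀ ∧ ¬ HasSobolevExtensionPast ν u T)) ∧
      (∀ T : ℝ, 0 < T →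
        ∀ (u₁ : ℝ → EuclideanSpace ℝ (Fin 3) → EuclideanSpace ℝ (Fin 3))
          (p₁ : ℝ → EuclideanSpace ℝ (Fin 3) → ℝ)
          (u₂ : ℝ → EuclideanSpace ℝ (Fin 3) → EuclideanSpace ℝ (Fin 3))
          (p₂ : ℝ → EuclideanSpace ℝ (Fin 3) → ℝ),
          IsLocalClassSolution ν T u₁ p₁ → IsLocalClassSolution ν T u₂ p₂ →
          u₁ 0 = u₀ → u₂ 0 = u₀ → ∀ t ∈ Ico 0 T, u₁ t = u₂ t)

/-- **Step 2 — the energy identity and inequality, eqs. (8)–(13) (pp. 9–10, Remark 3.2; the author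
cites Majda–Bertozzi Prop. 1.13, eq. (1.80)):** `E(T) + ν∫₀ᵀ∫|∇u|² = E(0)`, `dE/dt = −ν∫|∇u|² ≤ 0`,
hence `E(t) ≤ E(s)` for `s ≤ t` («for inviscid fluids E(t) = E(0)»), for solutions in the class on
`[0,T)` and on `[0,∞)`, `ν ≥ 0`. Typist's flag: plausible (known).
[cite: Kyritsis2021b, eqs. (8)–(13), pp. 9–10] -/
def Step_2 : Prop :=
  ∀ ν : ℝ, 0 ≤ ν →
    (∀ T : ℝ, 0 < T →
      ∀ (u : ℝ → EuclideanSpace ℝ (Fin 3) → EuclideanSpace ℝ (Fin 3))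
        (p : ℝ → EuclideanSpace ℝ (Fin 3) → ℝ), IsLocalClassSolution ν T u p →
      ∀ s ∈ Ico 0 T, ∀ t ∈ Ico 0 T, s ≤ t → energy u t ≤ energy u s) ∧
    (∀ (u : ℝ → EuclideanSpace ℝ (Fin 3) → EuclideanSpace ℝ (Fin 3))
        (p : ℝ → EuclideanSpace ℝ (Fin 3) → ℝ), IsGlobalClassSolution ν u p →
      ∀ s t : ℝ, 0 ≤ s → s ≤ t → energy u t ≤ energy u s)

/-- The data/force/admissibility spec of PROP 3.4's antecedent (p. 9): «smooth compact support …
initial data … and smooth compact support … external forcing for all times t > 0», finite energy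
solutions. (The printed «connected with smooth boundary» qualifications of the support are dropped —
this only strengthens the antecedent, i.e. weakens `Step_3`.) [cite: Kyritsis2021b, Prop 3.4, p. 9] -/
def compactSpec : ClayVariants.ClaySpec where
  data := fun u₀ => HasCompactSupport u₀
  force := fun f => ∃ K : Set (EuclideanSpace ℝ (Fin 3)), IsCompact K ∧
    ∀ t : ℝ, 0 ≤ t → Function.support (f t) ⊆ K
  admissible := fun u _ => HasBoundedEnergy u

/-- **Step 3 — PROP 3.4 (p. 9), «3D global smooth compact support non-homogeneous regularity implies
3D global smooth Schwartz homogeneous regularity»:** if every Cauchy problem with smooth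
divergence-free compactly supported data and smooth forcing compactly supported in space (for all
`t ≥ 0`) has a global smooth finite-energy solution (every `ν > 0`), then Clay (A) holds. Proof
deferred in print to the author's 2017 «Proposition 6.4» (after Tao 2013). Typist's flag: plausible;
NOT consumed by `claim_of_steps` (its antecedent is a forced-regularity statement that §§4–5 do not
establish). [cite: Kyritsis2021b, Prop 3.4, p. 9] -/
def Step_3 : Prop :=
  compactSpec.ForcedRegularity → ClayVariants.clayR3.Regularity

/-- **Step 4 — PROP 4.1 (pp. 15–17), «the pressures, necessary and sufficient condition for
regularity», in the reading consumed by the proof of PROP 5.2 (p. 22: «the pressures are smooth and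
bounded in finite time intervals (with smooth Schwartz initial data either on all 3-space or …) and
therefore we apply … PROPOSITION 4.1»):** for `ν > 0`, a solution in the class on `[0,T*)` whose
pressure has bounded OSCILLATION uniformly in `t < T*` — `|p(x₂,t) − p(x₁,t)| ≤ M` for all pairs of
points, which is what Prop 5.1 delivers and is insensitive to the normalisation `p ↦ p + c(t)` —
continues in the class past `T*`. As printed, Prop 4.1 is stated for «smooth compact connected
support initial data» with the bound «on the compact support V(t)»; Remark 3.11 (p. 15) announces
the Schwartz / whole-space reading used here. The printed proof (eqs. (24)–(27)) is not typed.
Typist's flag: plausible (a whole-space bounded-pressure regularity criterion is in print).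
[cite: Kyritsis2021b, Prop 4.1, pp. 15–17] -/
def Step_4 : Prop :=
  ∀ ν : ℝ, 0 < ν → ∀ T : ℝ, 0 < T →
    ∀ (u : ℝ → EuclideanSpace ℝ (Fin 3) → EuclideanSpace ℝ (Fin 3))
      (p : ℝ → EuclideanSpace ℝ (Fin 3) → ℝ), IsLocalClassSolution ν T u p →
    (∃ M : ℝ, ∀ t ∈ Ico 0 T, ∀ x₁ x₂ : EuclideanSpace ℝ (Fin 3), |p t x₂ - p t x₁| ≤ M) →
    HasSobolevExtensionPast ν u T

/-- **Step 5 — eqs. (34)–(35) (p. 20) and their repetition (37) at later times (p. 21), the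
INTERMEDIATE on which the printed proof of PROP 5.1 rests:** «this work that would be done by the
pressure forces of the original fluid at any time t, is real energy … and it would be subtracted from
the finite initial energy E(0) … Therefore: W ≤ E(0)» (35), «we can repeat this argument for later
times t … W(t) = c·V·|p(x₂(t)) − p(x₁(t))| ≤ E(t)» (37). Typed (ρ = c = 1): for `ν ≥ 0` (Prop 5.1
covers «Navier-Stokes … or Euler»), every solution in the class on `[0,T)`, every time `t < T`,
every pair of distinct points and EVERY double circular cone with these vertices (any base radius
`R > 0` — the text takes «at least one» such cone and argues for it with no restriction on `R`):
`V · |p(x₂,t) − p(x₁,t)| ≤ E(t)`. Typist's flag: known-false pattern (wide cones: `V → ∞` at fixed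
vertices; scaling: energy is supercritical). [cite: Kyritsis2021b, eqs. (34)–(35) p. 20 and (37) p. 21] -/
def Step_5 : Prop :=
  ∀ ν : ℝ, 0 ≤ ν → ∀ T : ℝ, 0 < T →
    ∀ (u : ℝ → EuclideanSpace ℝ (Fin 3) → EuclideanSpace ℝ (Fin 3))
      (p : ℝ → EuclideanSpace ℝ (Fin 3) → ℝ), IsLocalClassSolution ν T u p →
    ∀ t ∈ Ico 0 T, ∀ x₁ x₂ : EuclideanSpace ℝ (Fin 3), x₁ ≠ x₂ → ∀ R : ℝ, 0 < R →
      ENNReal.ofReal (coneWork p t x₁ x₂ R) ≤ energy u t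

/-- **Step 6 — PROPOSITION 5.1 (p. 19), «the finite energy, uniformly in time bounded
pressure-variance theorem», the statement PROP 5.2 consumes:** «Let a local in time, t in [0,T),
smooth flow solution … of the Navier-Stokes equations … or of Euler equations …, with smooth Schwartz
initial data, and finite initial energy E(0) … Then the pressure differences |p(x₂(t)) − p(x₁(t))|
for any two points x₁(t), x₂(t), for times that the solution exists, remain bounded by kE(0), where k
is a constant depending on the initial conditions.» Quantifier order as printed: `k` depends on the
datum only (it is uniform over the interval of existence and over the pairs of points). Typist's
flag: suspicious / open-strength (for `ν > 0` it gives regularity through `Step_4`; its printed proof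
is `step6_of_steps` below, resting on `Step_5`). [cite: Kyritsis2021b, Prop 5.1, p. 19] -/
def Step_6 : Prop :=
  ∀ ν : ℝ, 0 ≤ ν →
    ∀ u₀ : EuclideanSpace ℝ (Fin 3) → EuclideanSpace ℝ (Fin 3), ContDiff ℝ ∞ u₀ →
      NSWave0.IsDivFree u₀ → HasRapidSpatialDecay u₀ →
    ∃ k : ℝ, ∀ T : ℝ, 0 < T →
      ∀ (u : ℝ → EuclideanSpace ℝ (Fin 3) → EuclideanSpace ℝ (Fin 3))
        (p : ℝ → EuclideanSpace ℝ (Fin 3) → ℝ), IsLocalClassSolution ν T u p → u 0 = u₀ →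
      ∀ t ∈ Ico 0 T, ∀ x₁ x₂ : EuclideanSpace ℝ (Fin 3),
        ENNReal.ofReal |p t x₂ - p t x₁| ≤ ENNReal.ofReal k * energy u 0

/-! ## Kernel compositions of the paper's implications -/

/-- Bookkeeping: the `n = 0` Sobolev quantity of the BKM class is the `L²` energy integrand. [folklore] -/
private theorem lintegral_enorm_iteratedFDeriv_zero
    (f : EuclideanSpace ℝ (Fin 3) → EuclideanSpace ℝ (Fin 3)) :
    (∫⁻ x, ‖iteratedFDeriv ℝ 0 f x‖ₑ ^ 2) = ∫⁻ x, ‖f x‖ₑ ^ 2 := by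
  refine lintegral_congr fun x => ?_
  rw [← ofReal_norm, norm_iteratedFDeriv_zero, ofReal_norm]

/-- **The printed proof of PROP 5.1 composes from (35)/(37) and the energy inequality** (eqs.
(36)–(38), p. 21: «c·V·|p(x₂(t)) − p(x₁(t))| ≤ E(t) … E(t) ≤ E(0) … which is what it is required
to prove … k = 1/(cV)»): with the double cone of unit volume, `k = 1`.
[cite: Kyritsis2021b, proof of Prop 5.1, eqs. (36)–(38), p. 21] -/
theorem step6_of_steps (h2 : Step_2) (h5 : Step_5) : Step_6 := by
  intro ν hν u₀ _ _ _
  refine ⟨1, fun T hT u p hsol _ t ht x₁ x₂ => ?_⟩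
  rw [ENNReal.ofReal_one, one_mul]
  have hE : energy u t ≤ energy u 0 := (h2 ν hν).1 T hT u p hsol 0 ⟨le_rfl, hT⟩ t ht ht.1
  rcases eq_or_ne x₁ x₂ with h12 | h12
  · subst h12
    simp
  · have hW := h5 ν hν T hT u p hsol t ht x₁ x₂ h12 (Real.sqrt (3 / (Real.pi * ‖x₂ - x₁‖)))
      (Real.sqrt_pos.mpr (by
        have hd : 0 < ‖x₂ - x₁‖ := norm_pos_iff.mpr (sub_ne_zero.mpr (Ne.symm h12))
        positivity))
    rw [coneWork, doubleConeVolume_eq_one h12, one_mul] at hW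
    exact hW.trans hE

/-- **PROP 5.2's proof (p. 22) COMPOSES: the claimed theorem from Steps 1–6** (it consumes the
maximal-development alternative and uniqueness of `Step_1`, the pressure criterion `Step_4` and the
pressure-variance bound `Step_6`; hypotheses in step order, README Lean convention 4).
[cite: Kyritsis2021b, proof of Prop 5.2, p. 22] -/
theorem claim_of_steps : Step_1 → Step_2 → Step_3 → Step_4 → Step_5 → Step_6 → ClaimedTheorem := by
  intro h1 _ _ h4 _ h6 ν hν u₀ hu₀ hdiv hdec T hT u p hsol h0
  obtain ⟨halt, huniq⟩ := h1 ν hν u₀ hu₀ hdiv hdec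
  rcases halt with ⟨u', p', hglob, h0'⟩ | ⟨T', hT', u', p', hsol', h0', hmax⟩
  · -- the global solution of Step 1 restricts to the class on [0,T) and agrees with u by uniqueness
    refine ⟨u', p', hglob, ?_⟩
    have hloc : IsLocalClassSolution ν T u' p' :=
      ⟨hglob.1.mono (fun t ht => ht.1) (uniqueDiffOn_Ico 0 T),
        fun T'' _ => hglob.2 T''⟩
    exact huniq T hT u' p' u p hloc hsol h0' h0
  · -- a maximal solution with finite lifespan contradicts Prop 5.1 + Prop 4.1
    exfalso
    obtain ⟨k, hk⟩ := h6 ν hν.le u₀ hu₀ hdiv hdec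
    refine hmax (h4 ν hν T' hT' u' p' hsol'
      ⟨(ENNReal.ofReal k * energy u' 0).toReal, fun t ht x₁ x₂ => ?_⟩)
    have hb := hk T' hT' u' p' hsol' h0' t ht x₁ x₂
    -- the initial energy of a class solution is finite
    have hfin : energy u' 0 < ⊤ := by
      obtain ⟨C, hC⟩ := hsol'.2 (T' / 2) (by linarith) 0
      have hle : (∫⁻ x, ‖u' 0 x‖ₑ ^ 2) ≤ C := by
        rw [← lintegral_enorm_iteratedFDeriv_zero]
        exact hC 0 ⟨le_rfl, by linarith⟩
      unfold energy
      exact ENNReal.mul_lt_top (by simp) (hle.trans_lt ENNReal.coe_lt_top)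
    have hk0 : ENNReal.ofReal k * energy u' 0 ≠ ⊤ :=
      ENNReal.mul_ne_top ENNReal.ofReal_ne_top hfin.ne
    exact (ENNReal.ofReal_le_iff_le_toReal hk0).mp hb

/-- **The author's identification of PROP 5.2 with Conjecture (A)** (p. 2: «the conjecture (A) …
which I identify throughout the paper as the 4th Clay millennium problem»; p. 22: «Hence the solution
of the Clay Millennium problem in its original formulation»): with local existence in the class
(`Step_1`) and the energy inequality (`Step_2`, for (2.7)), the claimed continuation statement yields
Clay (A) = `ClayVariants.clayR3.Regularity`. [cite: Kyritsis2021b, §1 p. 2 and Prop 5.2 p. 22] -/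
theorem clayA_of_claimed (h1 : Step_1) (h2 : Step_2) (hc : ClaimedTheorem) :
    ClayVariants.clayR3.Regularity := by
  intro ν hν u₀ hu₀ hdiv hdec
  -- a solution in the class on some [0,T₀) from u₀
  obtain ⟨T₀, hT₀, u, p, hsol, h0⟩ : ∃ T₀ : ℝ, 0 < T₀ ∧
      ∃ (u : ℝ → EuclideanSpace ℝ (Fin 3) → EuclideanSpace ℝ (Fin 3))
        (p : ℝ → EuclideanSpace ℝ (Fin 3) → ℝ), IsLocalClassSolution ν T₀ u p ∧ u 0 = u₀ := by
    rcases (h1 ν hν u₀ hu₀ hdiv hdec).1 with ⟨u, p, hglob, h0⟩ | ⟨T, hT, u, p, hsol, h0, -⟩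
    · exact ⟨1, one_pos, u, p, ⟨hglob.1.mono (fun t ht => ht.1) (uniqueDiffOn_Ico 0 1),
        fun T'' _ => hglob.2 T''⟩, h0⟩
    · exact ⟨T, hT, u, p, hsol, h0⟩
  obtain ⟨u', p', hglob, hagree⟩ := hc ν hν u₀ hu₀ hdiv hdec T₀ hT₀ u p hsol h0
  have h0' : u' 0 = u₀ := by rw [hagree 0 ⟨le_rfl, hT₀⟩, h0]
  refine ⟨u', p', hglob.1.smooth_velocity, hglob.1.smooth_pressure,
    ⟨fun t ht x => hglob.1.momentum t ht x, fun t ht => hglob.1.divFree t ht, h0'⟩, ?_⟩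
  -- bounded energy (2.7) from the energy inequality and the finiteness of E(0)
  obtain ⟨C, hC⟩ := hglob.2 0 0
  have hE0 : (∫⁻ x, ‖u' 0 x‖ₑ ^ 2) ≤ C := by
    rw [← lintegral_enorm_iteratedFDeriv_zero]
    exact hC 0 ⟨le_rfl, le_rfl⟩
  refine ⟨C, ENNReal.coe_lt_top, fun t ht => ?_⟩
  have hmono := (h2 ν hν.le).2 u' p' hglob 0 t le_rfl ht
  unfold energy at hmono
  have h2ne : (2⁻¹ : ℝ≥0∞) ≠ 0 := by simp
  have h2top : (2⁻¹ : ℝ≥0∞) ≠ ⊤ := by simp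
  exact ((ENNReal.mul_le_mul_iff_right h2ne h2top).mp hmono).trans hE0


/-! ## Step 1 discharged: PROP 3.2 + 3.10, local well-posedness and the global-or-maximal alternative -/

/-- Sobolev bounds of a finite-energy classical solution from an `H^∞` datum on every closed slab
`[0,T'']`, `T''` arbitrary (Tao's class for `T'' > 0`; for `T'' ≤ 0` restrict from `[0, S]`). [folklore] -/
private theorem hasBoundedSobolevNormsOn_Icc_of_le {ν S : ℝ} (hν : 0 < ν) (hS : 0 < S)
    {u : ℝ → EuclideanSpace ℝ (Fin 3) → EuclideanSpace ℝ (Fin 3)} {p : ℝ → EuclideanSpace ℝ (Fin 3) → ℝ}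
    (hcl : IsClassicalNSSolutionOn (Icc 0 S) ν 0 u p) {A : ℝ≥0∞} (hA : A < ⊤)
    (hE : ∀ t ∈ Icc 0 S, ∫⁻ x, ‖u t x‖ₑ ^ 2 ≤ A)
    (h₀ : ∀ m : ℕ, ∫⁻ x, ‖iteratedFDeriv ℝ m (u 0) x‖ₑ ^ 2 < ⊤) {T'' : ℝ} (hT'' : T'' ≤ S) :
    HasBoundedSobolevNormsOn (Icc 0 T'') u :=
  (hcl.hasBoundedSobolevNormsOn_of_sobolevDatum_unforced hν hS
    ⟨A.toNNReal, fun t ht => (hE t ht).trans (ENNReal.coe_toNNReal hA.ne).ge⟩ h₀).mono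
    (Icc_subset_Icc_right hT'')

/-- **Step 1 HOLDS (kernel)** — PROP 3.2 + 3.10 (pp. 7–8, 13): local existence, uniqueness and the
global-or-maximal alternative in the Beale–Kato–Majda class, `ν > 0`, for smooth divergence-free rapidly
decaying data — by the tree's finite-energy classical dichotomy (`finiteEnergy_classical_dichotomy`),
persistence of regularity (`hasBoundedSobolevNormsOn_of_sobolevDatum_unforced`) and Sobolev-class
uniqueness (`MajdaBertozzi2002_uniquenessSobolev_holds`). The same statement is independently
kernel-certified Summits-side by the salvage lane
(`Summit.NavierStokesRegularity.NavierStokesRegularity.Theorems.Kyritsis2021Salvage.kyritsis2021_step1_holds`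
in `SoloSalvageKyritsis2021Step1.lean`, whose proof this discharge follows); it is re-proved here, where
the fact is declared, because Literature cannot import Summits. An in-file discharge of a step typed
«plausible»; no statement of the file is modified. [cite: Kyritsis2021b, Prop 3.2 pp. 7–8, Prop 3.10 p. 13]
[cite: MajdaBertozziCUP2002, Thm 3.4 p. 104, Cor 3.1 p. 88, Cor 3.2 p. 112] -/
theorem step_1_holds : Step_1 := by
  intro ν hν u₀ hu₀ hdiv hdecay
  have hdiv' : VectorCalculus.IsDivFree u₀ := fun x => hdiv x
  have hH : ∀ n : ℕ, ∫⁻ x, ‖iteratedFDeriv ℝ n u₀ x‖ₑ ^ 2 < ⊤ := fun n =>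
    hdecay.lintegral_enorm_iteratedFDeriv_sq_lt_top n
  refine ⟨?_, ?_⟩
  · -- the global-or-maximal alternative
    rcases finiteEnergy_classical_dichotomy hν hu₀ hdiv' hH with hall | hbad
    · -- global branch: patch, then read the class off Tao's persistence of regularity
      left
      have hH1 : MemLp (fderiv ℝ u₀) 2 volume := by
        have h1 : ∫⁻ x, ‖fderiv ℝ u₀ x‖ₑ ^ 2 < ⊤ := by
          refine lt_of_le_of_lt (le_of_eq (lintegral_congr fun x => ?_)) (hH 1)
          rw [← ofReal_norm, ← ofReal_norm, norm_iteratedFDeriv_one]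
        exact ⟨(hu₀.continuous_fderiv (by simp)).aestronglyMeasurable,
          eLpNorm_two_lt_top_of_lintegral_enorm_sq_lt_top h1⟩
      obtain ⟨u, p, hcl, hu0, ⟨E, hEtop, hEb⟩, -⟩ :=
        IsClassicalNSSolutionOn.exists_Ici_of_forall_Icc_finiteEnergy hν hH1 hall
      have h₀ : ∀ m : ℕ, ∫⁻ x, ‖iteratedFDeriv ℝ m (u 0) x‖ₑ ^ 2 < ⊤ := by rw [hu0]; exact hH
      refine ⟨u, p, ⟨hcl, fun T'' => ?_⟩, hu0⟩
      have hS : 0 < max T'' 1 := lt_max_of_lt_right one_pos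
      exact hasBoundedSobolevNormsOn_Icc_of_le hν hS
        (hcl.mono Icc_subset_Ici_self (uniqueDiffOn_Icc hS)) hEtop (fun t ht => hEb t ht.1) h₀
        (le_max_left _ _)
    · -- blow-up branch: the maximal solution on `[0,T*)` has no continuation in the class
      right
      obtain ⟨Ts, hTs, u, p, hcl, hu0, ⟨A, hAtop, hE⟩, -, hno⟩ := hbad
      have h₀ : ∀ m : ℕ, ∫⁻ x, ‖iteratedFDeriv ℝ m (u 0) x‖ₑ ^ 2 < ⊤ := by rw [hu0]; exact hH
      have hsob : ∀ T' : ℝ, 0 < T' → T' < Ts → HasBoundedSobolevNormsOn (Icc 0 T') u :=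
        fun T' hT' hT'T =>
          hasBoundedSobolevNormsOn_Icc_of_le hν hT'
            (hcl.mono (Icc_subset_Ico_right hT'T) (uniqueDiffOn_Icc hT')) hAtop
            (fun t ht => hE t ⟨ht.1, ht.2.trans_lt hT'T⟩) h₀ le_rfl
      refine ⟨Ts, hTs, u, p, ⟨hcl, fun T'' hT'' => ?_⟩, hu0, ?_⟩
      · exact (hsob (max T'' (Ts / 2)) (lt_max_of_lt_right (half_pos hTs))
          (max_lt hT'' (half_lt_self hTs))).mono (Icc_subset_Icc_right (le_max_left _ _))
      · rintro ⟨T', hT'Ts, v, q, hv, hvB, hagree⟩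
        have hv0 : v 0 = u₀ := by rw [hagree 0 ⟨le_rfl, hTs⟩, hu0]
        obtain ⟨C₀, hC₀⟩ := hvB 0
        exact hno Ts le_rfl v q (hv.mono (Icc_subset_Ico_right hT'Ts) (uniqueDiffOn_Icc hTs)) hv0
          ⟨C₀, ENNReal.coe_lt_top, fun t ht => by
            rw [lintegral_enorm_sq_eq_lintegral_iteratedFDeriv_zero]; exact hC₀ t ht⟩
  · -- uniqueness in the class on the common half-open slab
    intro T hT u₁ p₁ u₂ p₂ h₁ h₂ h₁0 h₂0 t ht
    set S : ℝ := (t + T) / 2 with hSdef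
    have hS0 : 0 < S := by rw [hSdef]; linarith [ht.1]
    have htS : t ≤ S := by rw [hSdef]; linarith [ht.2]
    have hST : S < T := by rw [hSdef]; linarith [ht.2]
    have hc₁ : IsClassicalNSSolutionOn (Icc 0 S) ν 0 u₁ p₁ :=
      h₁.1.mono (Icc_subset_Ico_right hST) (uniqueDiffOn_Icc hS0)
    have hc₂ : IsClassicalNSSolutionOn (Icc 0 S) ν 0 u₂ p₂ :=
      h₂.1.mono (Icc_subset_Ico_right hST) (uniqueDiffOn_Icc hS0)
    have h0 : u₁ 0 = u₂ 0 := by rw [h₁0, h₂0]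
    exact MajdaBertozzi2002_uniquenessSobolev_holds hν.le hS0 hc₁ hc₂ (h₁.2 S hST) (h₂.2 S hST) h0 t
      ⟨ht.1, htS⟩


/-! ## Step 2 discharged: the energy inequality `E(t) ≤ E(s)`, every `ν ≥ 0` (eqs. (8)–(13), pp. 9–10) -/

/-- Bookkeeping: a class solution has finite energy, uniformly on every `[0,t]`, `t < T` (the
`n = 0` clause of `HasBoundedSobolevNormsOn`; Props 3.1–3.2, pp. 7–8: `u ∈ L^∞_t H^k` for all `k`).
[cite: Kyritsis2021b, Props 3.1–3.2, pp. 7–8] -/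
theorem finiteEnergy_of_isLocalClassSolution {ν T : ℝ}
    {u : ℝ → EuclideanSpace ℝ (Fin 3) → EuclideanSpace ℝ (Fin 3)}
    {p : ℝ → EuclideanSpace ℝ (Fin 3) → ℝ} (hsol : IsLocalClassSolution ν T u p) {t : ℝ}
    (ht : t < T) : ∃ A : ℝ≥0∞, A < ⊤ ∧ ∀ τ ∈ Icc 0 t, ∫⁻ x, ‖u τ x‖ₑ ^ 2 ≤ A := by
  obtain ⟨C, hC⟩ := hsol.2 t ht 0
  refine ⟨C, ENNReal.coe_lt_top, fun τ hτ => ?_⟩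
  rw [← lintegral_enorm_iteratedFDeriv_zero]
  exact hC τ hτ

/-- Bookkeeping: `∇u ∈ L²_{t,x}` on a bounded slab from the class — if all Sobolev norms of `u`
are bounded on `[0, S]` then `∫₀^S∫|∇u|²_F ≤ 3 C₁ S < ∞` (`|∇u|²_F ≤ 3‖D¹u‖²`, the `n = 1`
clause). [folklore] -/
private theorem lintegral_frobeniusNormSq_lt_top_of_hasBoundedSobolevNormsOn
    {u : ℝ → EuclideanSpace ℝ (Fin 3) → EuclideanSpace ℝ (Fin 3)} {S : ℝ}
    (hB : HasBoundedSobolevNormsOn (Icc 0 S) u) :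
    ∫⁻ τ in Ioo 0 S, ∫⁻ x, ENNReal.ofReal (frobeniusNormSq (fderiv ℝ (u τ) x)) < ⊤ := by
  obtain ⟨C₁, hC₁⟩ := hB 1
  have hle : ∫⁻ τ in Ioo 0 S, ∫⁻ x, ENNReal.ofReal (frobeniusNormSq (fderiv ℝ (u τ) x)) ≤
      ∫⁻ _ in Ioo 0 S, 3 * (C₁ : ℝ≥0∞) :=
    setLIntegral_mono measurable_const fun τ hτ =>
      (lintegral_frobeniusNormSq_le_three_mul_iteratedFDeriv_one (u τ)).trans
        (by gcongr; exact hC₁ τ (Ioo_subset_Icc_self hτ))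
  refine hle.trans_lt ?_
  rw [setLIntegral_const, Real.volume_Ioo]
  exact ENNReal.mul_lt_top (ENNReal.mul_lt_top (by norm_num) ENNReal.coe_lt_top) ENNReal.ofReal_lt_top

/-- Bookkeeping: from the real kinetic energies `½∫|u|²` to the `ℝ≥0∞` energies of this file
(`energy u t = ½∫⁻‖u‖ₑ²`), for `L²` slices. [folklore] -/
private theorem energy_le_energy_of_kineticEnergy_le
    {u : ℝ → EuclideanSpace ℝ (Fin 3) → EuclideanSpace ℝ (Fin 3)} {s t : ℝ}
    (hs : MemLp (u s) 2 volume) (ht : MemLp (u t) 2 volume)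
    (h : VectorCalculus.kineticEnergy (u t) ≤ VectorCalculus.kineticEnergy (u s)) :
    energy u t ≤ energy u s := by
  unfold energy
  have e1 : (∫⁻ x, ‖u t x‖ₑ ^ 2) = eEnergy (u t) := rfl
  have e2 : (∫⁻ x, ‖u s x‖ₑ ^ 2) = eEnergy (u s) := rfl
  rw [e1, e2, eEnergy_eq_ofReal _ ht, eEnergy_eq_ofReal _ hs]
  gcongr

/-- **The energy inequality for class solutions on `[0,T)`, every `ν ≥ 0`**: `E(t) ≤ E(s)` for
`0 ≤ s ≤ t < T` (eq. (13), p. 10; for `ν = 0` with equality, eq. (12)). Proof (Leray 1934 (3.4) =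
Tao 2013 Lemma 8.1, in the tree for every `ν ≥ 0`): restrict to the closed slab `[0, t]`; the class
gives finite energy (`n = 0`), `∇u ∈ L²_{t,x}` (`n = 1`) and hence `u ∈ L³_{t,x}`; Leray's identity
`½‖u(t)‖₂² + ν∫ₛᵗ∫|∇u|²_F = ½‖u(s)‖₂²` (`IsClassicalNSSolutionOn.energyEq_of_finiteEnergy_nonneg`)
and `ν∫∫|∇u|²_F ≥ 0`. [cite: Kyritsis2021b, eqs. (8)–(13), pp. 9–10]
[cite: MajdaBertozziCUP2002, Prop. 1.13 (1.80) p. 28] -/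
theorem energy_antitone_of_isLocalClassSolution_nonneg {ν T : ℝ} (hν : 0 ≤ ν)
    {u : ℝ → EuclideanSpace ℝ (Fin 3) → EuclideanSpace ℝ (Fin 3)}
    {p : ℝ → EuclideanSpace ℝ (Fin 3) → ℝ} (hsol : IsLocalClassSolution ν T u p)
    {s t : ℝ} (hs : s ∈ Ico 0 T) (ht : t ∈ Ico 0 T) (hst : s ≤ t) :
    energy u t ≤ energy u s := by
  rcases hst.eq_or_lt with h | hlt
  · rw [h]
  have ht0 : 0 < t := hs.1.trans_lt hlt
  have hcl : IsClassicalNSSolutionOn (Icc 0 t) ν 0 u p :=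
    hsol.1.mono (fun τ hτ => ⟨hτ.1, hτ.2.trans_lt ht.2⟩) (uniqueDiffOn_Icc ht0)
  obtain ⟨A, hAt, hA⟩ := finiteEnergy_of_isLocalClassSolution hsol ht.2
  have hgrad := lintegral_frobeniusNormSq_lt_top_of_hasBoundedSobolevNormsOn (hsol.2 t ht.2)
  have hu₃ := hcl.lintegral_enorm_pow_three_lt_top hAt.ne hA hgrad
  have hid := hcl.energyEq_of_finiteEnergy_nonneg hν ht0 hAt.ne hA hgrad hu₃ hs.1 hlt.le le_rfl
  have hD : 0 ≤ ν * (∫⁻ τ in Ioo s t, ∫⁻ x,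
      ENNReal.ofReal (frobeniusNormSq (fderiv ℝ (u τ) x))).toReal :=
    mul_nonneg hν ENNReal.toReal_nonneg
  have hKE : VectorCalculus.kineticEnergy (u t) ≤ VectorCalculus.kineticEnergy (u s) := by linarith
  have hmem : ∀ τ ∈ Icc 0 t, MemLp (u τ) 2 volume := fun τ hτ =>
    memLp_two_of_lintegral_lt_top (hcl.contDiff_velocity hτ).continuous ((hA τ hτ).trans_lt hAt)
  exact energy_le_energy_of_kineticEnergy_le (hmem s ⟨hs.1, hlt.le⟩) (hmem t ⟨ht0.le, le_rfl⟩) hKE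

/-- **The energy inequality for global class solutions, every `ν ≥ 0`**: `E(t) ≤ E(s)` for
`0 ≤ s ≤ t` (a global class solution restricts to a class solution on `[0, t+1)`).
[cite: Kyritsis2021b, eqs. (8)–(13), pp. 9–10] -/
theorem energy_antitone_of_isGlobalClassSolution_nonneg {ν : ℝ} (hν : 0 ≤ ν)
    {u : ℝ → EuclideanSpace ℝ (Fin 3) → EuclideanSpace ℝ (Fin 3)}
    {p : ℝ → EuclideanSpace ℝ (Fin 3) → ℝ} (hsol : IsGlobalClassSolution ν u p)
    {s t : ℝ} (hs : 0 ≤ s) (hst : s ≤ t) : energy u t ≤ energy u s := by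
  have hloc : IsLocalClassSolution ν (t + 1) u p :=
    ⟨hsol.1.mono (fun τ hτ => hτ.1) (uniqueDiffOn_Ico 0 (t + 1)), fun T'' _ => hsol.2 T''⟩
  exact energy_antitone_of_isLocalClassSolution_nonneg hν hloc ⟨hs, by linarith⟩
    ⟨hs.trans hst, by linarith⟩ hst

/-- **Step 2 HOLDS (kernel) — for every `ν ≥ 0`** (eqs. (8)–(13), pp. 9–10; Majda–Bertozzi Prop.
1.13 (1.80); Leray 1934 (3.4)): both clauses of the typed `Step_2`, the energy inequality for class
solutions on `[0,T)` and on `[0,∞)`, Euler (`ν = 0`) included. The same statement is independently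
kernel-certified Summits-side by the salvage lane
(`Summit.NavierStokesRegularity.NavierStokesRegularity.Theorems.Kyritsis2021Salvage.kyritsis2021_step2_holds`
in `SoloSalvageKyritsis2021Step2.lean`, whose proof this discharge follows verbatim); it is re-proved
here, where the fact is declared, because Literature cannot import Summits. An in-file discharge of a
step typed «plausible (known)»; no statement of the file is modified.
[cite: Kyritsis2021b, eqs. (8)–(13), pp. 9–10] [cite: MajdaBertozziCUP2002, Prop. 1.13 (1.80) p. 28] -/
theorem step_2_holds : Step_2 := fun _ν hν =>
  ⟨fun _ _ _ _ hsol _ hs _ ht hst => energy_antitone_of_isLocalClassSolution_nonneg hν hsol hs ht hst,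
    fun _ _ hsol _ _ hs hst => energy_antitone_of_isGlobalClassSolution_nonneg hν hsol hs hst⟩


section Step4

open Metric Function
open scoped NNReal

/-! ## Step 4 discharged: PROP 4.1 (pp. 15–17) — bounded pressure oscillation ⇒ continuation, `ν > 0`,
via Seregin–Šverák 2002 (pressure bounded below ⇒ no blow-up) -/

/-- A classical solution stays classical when the velocity is modified at times outside the time set
`S` (every clause of `IsClassicalNSSolutionOn` sees only the slices `u t`, `t ∈ S`, and the time
derivative WITHIN `S`). In-file copy of the tree lemma `IsClassicalNSSolutionOn.congr_velocity`
(`NSLerayStrongLocalExistence.lean`), kept private to keep the import cone small. [folklore] -/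
private theorem isClassicalNSSolutionOn_congr_velocity {S : Set ℝ} {ν : ℝ}
    {u v : ℝ → EuclideanSpace ℝ (Fin 3) → EuclideanSpace ℝ (Fin 3)}
    {p : ℝ → EuclideanSpace ℝ (Fin 3) → ℝ} (h : IsClassicalNSSolutionOn S ν 0 u p)
    (huv : ∀ t ∈ S, v t = u t) : IsClassicalNSSolutionOn S ν 0 v p where
  smooth_velocity :=
    h.smooth_velocity.congr fun z hz => by
      change v z.1 z.2 = u z.1 z.2
      rw [huv z.1 (mem_prod.1 hz).1]
  smooth_pressure := h.smooth_pressure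
  momentum t ht x := by
    have h1 : timeDerivWithin S v t x = timeDerivWithin S u t x := by
      simp only [timeDerivWithin]
      exact derivWithin_congr (fun s hs => by rw [huv s hs]) (by rw [huv t ht])
    rw [h1, huv t ht]
    exact h.momentum t ht x
  divFree t ht := by
    rw [huv t ht]
    exact h.divFree t ht

/-- A bounded velocity field on `[0,T) × ℝ³` with continuous slices has every component in
`L^∞_t L^∞_x` on `(0,T)` (the tree's mixed-norm class `MemLqLp ∞ ∞`). [folklore] -/
private theorem memLqLp_top_top_component {T M : ℝ}
    {u : ℝ → EuclideanSpace ℝ (Fin 3) → EuclideanSpace ℝ (Fin 3)}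
    (hcont : ∀ t ∈ Ico 0 T, Continuous (u t)) (hM : ∀ t ∈ Ico 0 T, ∀ x, ‖u t x‖ ≤ M) (j : Fin 3) :
    MemLqLp ∞ ∞ (fun t x => u t x j) (Ioo 0 T) := by
  refine memLqLp_top_of_ae_slice_bound (C := ENNReal.ofReal M) ENNReal.ofReal_ne_top ?_
  refine (ae_restrict_iff' measurableSet_Ioo).2 (ae_of_all _ fun t ht => ?_)
  have htI : t ∈ Ico 0 T := ⟨ht.1.le, ht.2⟩
  have hmeas : AEStronglyMeasurable (fun x => u t x j) volume :=
    (((EuclideanSpace.proj j : EuclideanSpace ℝ (Fin 3) →L[ℝ] ℝ).continuous).comp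
      (hcont t htI)).aestronglyMeasurable
  have hbound : ∀ᵐ x ∂(volume : Measure (EuclideanSpace ℝ (Fin 3))), ‖u t x j‖ ≤ M :=
    ae_of_all _ fun x => (PiLp.norm_apply_le (u t x) j).trans (hM t htI x)
  refine ⟨memLp_top_of_bound hmeas M hbound, ?_⟩
  rw [eLpNorm_exponent_top]
  exact eLpNormEssSup_le_of_ae_bound hbound

/-- **A class solution on `[0,T)` is a Leray–Hopf weak solution on every `[0,T']`, `T' < T`** (Leray
1934 §17: regular solutions are turbulent solutions; tree `isLerayHopfOn_translate_of_finiteEnergy` at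
the restart time `0`, the class supplying finite energy on `[0,T']`). [cite: Leray1934, §17 (3.4) and §32 p. 242] -/
theorem isLerayHopfOn_of_isLocalClassSolution {ν T : ℝ} (hν : 0 < ν)
    {u : ℝ → EuclideanSpace ℝ (Fin 3) → EuclideanSpace ℝ (Fin 3)}
    {p : ℝ → EuclideanSpace ℝ (Fin 3) → ℝ} (hsol : IsLocalClassSolution ν T u p)
    {T' : ℝ} (hT' : 0 < T') (hT'T : T' < T) : IsLerayHopfOn T' ν 0 (u 0) u := by
  have hcl : IsClassicalNSSolutionOn (Icc 0 T') ν 0 u p :=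
    hsol.1.mono (Icc_subset_Ico_right hT'T) (uniqueDiffOn_Icc hT')
  have h := (isLerayHopfOn_translate_of_finiteEnergy hcl hν le_rfl hT'
    (finiteEnergy_of_isLocalClassSolution hsol hT'T)).1
  simpa using h

/-- **From bounded pressure OSCILLATION to a FLOOR on the normalised pressure.** For a class solution
on `[0,T)`, `ν > 0`, whose pressure has oscillation `≤ M` at every time, the normalised pressure
`p̃(t) = RᵢRⱼ(uᵢuⱼ)(t)` satisfies `p̃(t,x) ≥ -(M + 1)` on `(0,T) × ℝ³`: at interior times
`p(t) = p̃(t) + c(t)` (Tao 2011 Lemma 4.1 (i), tree `pressure_sub_pressurePotential_eq` +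
`normalisedPressure_eq_pressurePotential`), so `p̃(t)` has the same oscillation; and `p̃(t) ∈ L^{3/2}`
(slice in `L² ∩ L^∞`, Stein) cannot stay above `1` in absolute value on all of `ℝ³`.
[cite: Tao2011, Lemma 4.1 (i)] [cite: Stein1971, Ch. II §4.2 Thm. 3] -/
theorem normalisedPressure_floor_of_oscillation {ν T : ℝ} (hν : 0 < ν)
    {u : ℝ → EuclideanSpace ℝ (Fin 3) → EuclideanSpace ℝ (Fin 3)}
    {p : ℝ → EuclideanSpace ℝ (Fin 3) → ℝ} (hsol : IsLocalClassSolution ν T u p) {M : ℝ}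
    (hM : ∀ t ∈ Ico 0 T, ∀ x₁ x₂ : EuclideanSpace ℝ (Fin 3), |p t x₂ - p t x₁| ≤ M) :
    ∀ t ∈ Ioo 0 T, ∀ x, -(M + 1) ≤ normalisedPressure (u t) x := by
  intro t ht x
  -- a closed slab `[0,T']` containing `t` in its interior
  set T' : ℝ := (t + T) / 2 with hT'def
  have htT' : t < T' := by rw [hT'def]; linarith [ht.2]
  have hT'T : T' < T := by rw [hT'def]; linarith [ht.2]
  have hT'0 : 0 < T' := ht.1.trans htT'
  have htI : t ∈ Icc 0 T' := ⟨ht.1.le, htT'.le⟩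
  have hcl : IsClassicalNSSolutionOn (Icc 0 T') ν 0 u p :=
    hsol.1.mono (Icc_subset_Ico_right hT'T) (uniqueDiffOn_Icc hT'0)
  obtain ⟨A, hAt, hA⟩ := finiteEnergy_of_isLocalClassSolution hsol hT'T
  have hint : ∀ τ ∈ Icc 0 T', Integrable fun y => ‖u τ y‖ ^ 2 := fun τ hτ =>
    integrable_sq_of_lintegral_enorm_sq_lt_top (hcl.contDiff_velocity hτ).continuous
      ((hA τ hτ).trans_lt hAt)
  have hE : ∀ τ ∈ Icc 0 T', ∫ y, ‖u τ y‖ ^ 2 ≤ A.toReal := fun τ hτ => by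
    have h1 := hA τ hτ
    rw [← ofReal_integral_norm_sq_eq_lintegral (hint τ hτ)] at h1
    exact (ENNReal.ofReal_le_iff_le_toReal hAt.ne).1 h1
  -- `p(t) = p̃(t) + c` with `c = p(t,0) - Q[u(t)](0)`
  have hu2 : ContDiff ℝ 2 (u t) := (hcl.contDiff_velocity htI).of_le (by norm_cast)
  have hQ : ∀ y, normalisedPressure (u t) y = p t y - (p t 0 - pressurePotential (u t) 0) := by
    intro y
    rw [normalisedPressure_eq_pressurePotential hu2 (hint t htI) y]
    have := pressure_sub_pressurePotential_eq hν.le hcl ENNReal.toReal_nonneg hint hE ⟨ht.1, htT'⟩ y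
    linarith
  -- the slice `p̃(t)` is in `L^{3/2}`
  obtain ⟨B, -, hB⟩ := exists_forall_norm_le_of_hasBoundedSobolevNormsOn hcl (hsol.2 T' hT'T)
  have hv2 : MemLp (u t) 2 volume :=
    memLp_two_of_lintegral_lt_top (hcl.contDiff_velocity htI).continuous ((hA t htI).trans_lt hAt)
  have hp32 : MemLp (normalisedPressure (u t)) (3 / 2) volume :=
    LeslieShvydkoy2018.memLp_normalisedPressure_threeHalves hv2 (hB t htI)
  -- hence it is `< 1` in absolute value somewhere
  obtain ⟨x₀, hx₀⟩ : ∃ x₀, ‖normalisedPressure (u t) x₀‖ < 1 := by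
    by_contra hcon
    simp only [not_exists, not_lt] at hcon
    have hfin := hp32.meas_ge_lt_top (by norm_num)
      (ne_of_lt (ENNReal.div_lt_top (by norm_num) (by norm_num))) (ε := 1) one_ne_zero
    have huniv : {y : EuclideanSpace ℝ (Fin 3) | (1 : ℝ≥0) ≤ ‖normalisedPressure (u t) y‖₊} = univ := by
      refine eq_univ_of_forall fun y => ?_
      have h1 := hcon y
      change (1 : ℝ≥0) ≤ ‖normalisedPressure (u t) y‖₊
      rw [← NNReal.coe_le_coe, coe_nnnorm]
      exact_mod_cast h1
    rw [huniv, measure_univ_of_isAddLeftInvariant] at hfin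
    exact lt_irrefl _ hfin
  -- oscillation transfer
  have hosc : |normalisedPressure (u t) x - normalisedPressure (u t) x₀| ≤ M := by
    rw [hQ x, hQ x₀]
    have h := hM t ⟨ht.1.le, ht.2⟩ x₀ x
    have e : p t x - (p t 0 - pressurePotential (u t) 0) - (p t x₀ - (p t 0 - pressurePotential (u t) 0))
        = p t x - p t x₀ := by ring
    rw [e]; exact h
  have h0 : -1 < normalisedPressure (u t) x₀ := by
    rw [Real.norm_eq_abs] at hx₀
    exact (abs_lt.1 hx₀).1
  have h1 := (abs_le.1 hosc).1
  linarith

/-- **Step 4 HOLDS (kernel) — PROP 4.1 (pp. 15–17) in the reading consumed by PROP 5.2: bounded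
pressure oscillation on `[0,T*)` ⇒ continuation in the class past `T*`, `ν > 0`.** Proof, entirely
from tree theorems (the printed proof, eqs. (24)–(27), is not used): (i) a class solution on `[0,T)` is
Leray–Hopf on every `[0,T']` (`isLerayHopfOn_of_isLocalClassSolution`) hence, after redefining the
final slice as the weak `L²` limit (`exists_isLerayHopfOn_update_of_forall_lt`), Leray–Hopf on
`[0,T]`, the updated field being the same classical solution on `[0,T)`; (ii) bounded oscillation of
`p` gives the FLOOR `p̃ ≥ -(M+1)` for the normalised pressure (`normalisedPressure_floor_of_oscillation`);
(iii) **Seregin–Šverák 2002** (pressure bounded below ⇒ no singular point up to `T`; tree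
`SereginSverak2002.isBackwardBoundedAt_of_floor`) with the far-field/near-field bounds
(`SereginSverak2002.farField_bound`, `nearField_bound`) gives `|u| ≤ M'` on `(T/4, T) × ℝ³`, and the
class gives `|u| ≤ B` on `[0, T/2] × ℝ³` (Sobolev); (iv) the `L^∞_t L^∞_x` endpoint of the
two-velocity-components criterion (`baeChoe_two_velocity_components_criterion_top_of_le`) continues
the solution in the Beale–Kato–Majda class past `T`. An in-file discharge of a step typed
«plausible»; no statement of the file is modified. [cite: Kyritsis2021b, Prop 4.1, pp. 15–17]
[cite: SereginSverak2002, Main Theorem (abstract), case p ≥ -g] -/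
theorem step_4_holds : Step_4 := by
  intro ν hν T hT u p hsol hM
  obtain ⟨M, hM⟩ := hM
  -- (i) Leray–Hopf on `[0,T]` after updating the final slice
  have hLH' : ∀ T' ∈ Ioo 0 T, IsLerayHopfOn T' ν 0 (u 0) u := fun T' hT' =>
    isLerayHopfOn_of_isLocalClassSolution hν hsol hT'.1 hT'.2
  obtain ⟨Y, -, hLHv⟩ := exists_isLerayHopfOn_update_of_forall_lt hT hν hLH'
  set v : ℝ → EuclideanSpace ℝ (Fin 3) → EuclideanSpace ℝ (Fin 3) := Function.update u T Y with hv
  have hagree : ∀ t ∈ Ico 0 T, v t = u t := fun t ht => Function.update_of_ne (ne_of_lt ht.2) Y u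
  have hv0 : v 0 = u 0 := hagree 0 ⟨le_rfl, hT⟩
  have hclv : IsClassicalNSSolutionOn (Ico 0 T) ν 0 v p :=
    isClassicalNSSolutionOn_congr_velocity hsol.1 hagree
  have hLHv' : IsLerayHopfOn T ν 0 (v 0) v := by rw [hv0]; exact hLHv
  -- (ii) the floor on the normalised pressure
  have hfloor : ∀ t ∈ Ioo 0 T, ∀ x, -(M + 1) ≤ normalisedPressure (v t) x := fun t ht x => by
    rw [hagree t ⟨ht.1.le, ht.2⟩]
    exact normalisedPressure_floor_of_oscillation hν hsol hM t ht x
  -- (iii) Seregin–Šverák: no singular point at `T`; far and near field ⇒ bounded on `(T/4, T) × ℝ³`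
  have hloc : ∀ x₀ : EuclideanSpace ℝ (Fin 3), IsBackwardBoundedAt v T x₀ := fun x₀ =>
    SereginSverak2002.isBackwardBoundedAt_of_floor hν hT hclv hLHv' hfloor ⟨hT, le_rfl⟩ x₀
  have hδ : 0 < T / 4 := by positivity
  obtain ⟨R, M₁, hfar⟩ := SereginSverak2002.farField_bound hν hT hclv hLHv' hδ
  obtain ⟨M₂, hnear⟩ :=
    SereginSverak2002.nearField_bound hT (SereginSverak2002.continuousOn_uncurry hclv) hloc hδ R
  -- the class bound on `[0, T/2]`
  have hT2 : 0 < T / 2 := by positivity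
  have hclhalf : IsClassicalNSSolutionOn (Icc 0 (T / 2)) ν 0 u p :=
    hsol.1.mono (Icc_subset_Ico_right (by linarith)) (uniqueDiffOn_Icc hT2)
  obtain ⟨B, -, hB⟩ := exists_forall_norm_le_of_hasBoundedSobolevNormsOn hclhalf
    (hsol.2 (T / 2) (by linarith))
  -- a uniform bound on `[0,T) × ℝ³`
  have hbound : ∀ t ∈ Ico 0 T, ∀ x, ‖u t x‖ ≤ max B (max M₁ M₂) := by
    intro t ht x
    by_cases hth : t ≤ T / 2
    · exact (hB t ⟨ht.1, hth⟩ x).trans (le_max_left _ _)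
    · have htq : T / 4 < t := by linarith [not_le.1 hth]
      rw [← hagree t ht]
      by_cases hx : R < ‖x‖
      · exact (hfar t ⟨htq, ht.2⟩ x hx).trans ((le_max_left _ _).trans (le_max_right _ _))
      · have h := hnear (t, x) ⟨⟨htq.le, ht.2.le⟩, mem_closedBall_zero_iff.2 (not_lt.1 hx)⟩ ht.2
        exact h.trans ((le_max_right _ _).trans (le_max_right _ _))
  -- (iv) the `L^∞` endpoint criterion
  have hcont : ∀ t ∈ Ico 0 T, Continuous (u t) := fun t ht =>
    (hsol.1.contDiff_velocity ht).continuous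
  exact baeChoe_two_velocity_components_criterion_top_of_le hν hT hsol.1 hsol.2 (α := ⊤) le_top 0
    fun j _ => memLqLp_top_top_component hcont hbound j

end Step4

end

end Literature.Claims.NS.Kyritsis2021
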